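import Literature.NumberTheory.DiophantineGeometry.FunctionFieldResidues
import Literature.NumberTheory.DiophantineGeometry.FunctionFieldGenusApproximationProofs
import Literature.NumberTheory.DiophantineGeometry.FunctionFieldDivisorsAdicProofs
import Literature.NumberTheory.DiophantineGeometry.FunctionFieldDivisorClasses
import HarnessLib

/-!
# `ℓ(Q) = 1` for a rational place `Q` of a function field of genus `≥ 1`

Topic `NumberTheory/DiophantineGeometry`, namespace
`Literature.NumberTheory.DiophantineGeometry.AlgFunctionField`; THEOREMS ONLY (no definition, no
named fact, no instance, sorry-free).

For an algebraic function field `F/K` of one variable with full constant field `K` and a rational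
place `Q`:

* **`ell_single_eq_one_of_one_le_genus`**: if `g ≥ 1` then `ℓ(Q) = 1`, i.e. `L(Q) = K` — a
  non-constant `x ∈ L(Q)` would have pole divisor `(x)_∞ = Q`, so `1, x, …, xⁿ ∈ L(nQ)` are
  `K`-linearly independent and `ℓ(nQ) ≥ n + 1`, contradicting Riemann–Roch `ℓ(nQ) = n + 1 − g`
  for `n = 2g − 1` (Stichtenoth Thm. 1.4.17 / Thm. 1.5.17; equivalently Prop. 1.6.3: a function
  field with a rational place `Q` and `ℓ(Q) ≥ 2` is rational, hence of genus `0`). This is the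
  function-field form of the first step of Milne, *Jacobian Varieties*, Prop. 2.3 («if `g > 0`, no
  two distinct points of `C` are linearly equivalent»);
* **`riemannRochSpace_single_eq_bot_of_one_le_genus`**: `L(Q) = K · 1`;
* **`single_isLinearlyEquivalent_single_iff_of_one_le_genus`** /
  **`eq_of_single_isLinearlyEquivalent_single`**: for rational places `P, Q` of a function field of
  genus `≥ 1`, `P ∼ Q` (as divisors) iff `P = Q`;
* §2 (ed. 2) **`ell_differentialDivisor_sub_single_of_one_le_genus`**: for `g ≥ 1`, a canonical
  divisor `W = (ω)` and a rational place `Q`, `ℓ(W − Q) = g − 1 = ℓ(W) − 1` — the canonical system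
  has no base point at `Q` (Riemann–Roch, Stichtenoth Thm. 1.5.15, applied to `A = Q` with `ℓ(Q) = 1`;
  Hartshorne IV Prop. 3.1 (a) / Lemma 5.1).

Cell `hodgecm-mathlib` (D-0151), count-neutral capital (the (W1) Weil–Jacobian lineage: injectivity of
the Abel–Jacobi map on points, `Motives/JacobianAbelJacobiInjective`). HC_CM is proved only modulo the
7 printed citations until rung 0 closes; this file discharges none of them.

## References

* H. Stichtenoth, *Algebraic Function Fields and Codes*, 2nd ed., GTM 254, Springer 2009:
  Lemma 1.4.7, Thm. 1.4.17, Thm. 1.5.17, Prop. 1.6.3. [Stichtenoth2009]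
* J. S. Milne, *Jacobian Varieties*, in *Arithmetic Geometry* (Storrs 1984), Springer 1986, §2
  Prop. 2.3 (proof). [Milne1986JacobianVarieties]
-/

noncomputable section

namespace Literature.NumberTheory.DiophantineGeometry.AlgFunctionField

open Polynomial

universe u v

variable {K : Type u} {F : Type v} [Field K] [Field F] [Algebra K F]
variable [IsAlgFunctionField K F] [IsIntegrallyClosedIn K F]

omit [IsAlgFunctionField K F] in
/-- The powers `1, x, …, xⁿ` of an element `x ∉ K` (hence transcendental over the full constant
field `K`) are `K`-linearly independent. [folklore] -/
private theorem linearIndependent_pow_of_not_mem_range {x : F} (hx : x ∉ Set.range (algebraMap K F))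
    (n : ℕ) : LinearIndependent K fun i : Fin (n + 1) => x ^ (i : ℕ) := by
  have hxt : Transcendental K x := transcendental_of_not_mem_range hx
  refine Fintype.linearIndependent_iff.2 fun g hg i => ?_
  simp_rw [Algebra.smul_def, ← aeval_monomial, ← map_sum] at hg
  -- the polynomial `Σ gᵢ Xⁱ` kills `x`, hence vanishes
  have hp : (∑ i : Fin (n + 1), monomial (i : ℕ) (g i)) = 0 := by
    by_contra hp
    exact hxt ⟨_, hp, hg⟩
  have h := congrArg (fun p : K[X] => p.coeff i) hp
  simp only [finsetSum_coeff, coeff_monomial, Fin.val_eq_val, Finset.sum_ite_eq',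
    Finset.mem_univ, if_true, coeff_zero] at h
  exact h

omit [IsAlgFunctionField K F] [IsIntegrallyClosedIn K F] in
/-- For `x ∈ L(Q)`, `x ≠ 0`, and `i ≤ n`: `xⁱ ∈ L(nQ)` (`ord_v (xⁱ) = i · ord_v x ≥ 0` away from
`Q`, `≥ −i ≥ −n` at `Q`). [cite: Stichtenoth2009, Def. 1.1.9 (2) and Def. 1.4.4] -/
theorem pow_mem_riemannRochSpace_single {Q : PlaceOver K F} {x : F} (hx0 : x ≠ 0)
    (hx : x ∈ riemannRochSpace (Finsupp.single Q (1 : ℤ))) {i n : ℕ} (hin : i ≤ n) :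
    x ^ i ∈ riemannRochSpace (Finsupp.single Q (n : ℤ)) := by
  have hord := (mem_riemannRochSpace_iff_neg_le_ord _ hx0).1 hx
  rw [mem_riemannRochSpace_iff_neg_le_ord _ (pow_ne_zero i hx0)]
  intro v
  rw [v.ord_pow hx0 i]
  by_cases hv : v = Q
  · subst hv
    have h := hord v
    rw [Finsupp.single_eq_same] at h ⊢
    have : (i : ℤ) * (-1) ≤ (i : ℤ) * v.ord x :=
      mul_le_mul_of_nonneg_left h (by exact_mod_cast (Nat.zero_le i))
    have hin' : (i : ℤ) ≤ n := by exact_mod_cast hin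
    linarith
  · have h := hord v
    rw [Finsupp.single_eq_of_ne hv, neg_zero] at h ⊢
    exact mul_nonneg (by exact_mod_cast (Nat.zero_le i)) h

/-- `1 ≤ ℓ(D)` for `D ≥ 0` (`K ⊆ L(0) ⊆ L(D)`, Stichtenoth Lemma 1.4.7 (a) / 1.4.8).
[cite: Stichtenoth2009, Lemma 1.4.7 (a)] -/
theorem one_le_ell_of_nonneg {D : Divisor K F} (hD : 0 ≤ D) : 1 ≤ ell D := by
  haveI := finiteDimensional_riemannRochSpace_of_isAlgFunctionField (K := K) (F := F) D
  have h := Submodule.finrank_mono (riemannRochSpace_mono (K := K) (F := F) hD)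
  rw [show Module.finrank K (riemannRochSpace (0 : Divisor K F)) = 1 from ell_zero_eq_one] at h
  exact h

/-- **`ℓ(Q) = 1` for a rational place `Q` when `g ≥ 1`** (Stichtenoth: Prop. 1.6.3 says that
`ℓ(Q) ≥ 2` at a rational place makes `F = K(x)` rational, of genus `0`; here directly from
Riemann–Roch Thm. 1.5.17: a non-constant `x ∈ L(Q)` gives `ℓ((2g−1)Q) ≥ 2g`, while
`ℓ((2g−1)Q) = g`). Milne, *Jacobian Varieties*, proof of Prop. 2.3: for `g > 0` no two distinct
points are linearly equivalent. [cite: Stichtenoth2009, Prop. 1.6.3 and Thm. 1.5.17] [cite: Milne1986JacobianVarieties, §2 Prop. 2.3 (proof)] -/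
theorem ell_single_eq_one_of_one_le_genus {Q : PlaceOver K F} (hQ : Q.IsRational)
    (hg : 1 ≤ genus K F) : ell (Finsupp.single Q (1 : ℤ)) = 1 := by
  classical
  set D : Divisor K F := Finsupp.single Q 1 with hD
  have h1 : 1 ≤ ell D := one_le_ell_of_nonneg (Finsupp.single_nonneg.2 zero_le_one)
  by_contra hne
  have h2 : 2 ≤ ell D := by omega
  -- a non-constant element of `L(Q)`
  have hex : ∃ x ∈ riemannRochSpace D, x ∉ Set.range (algebraMap K F) := by
    by_contra hne'
    push Not at hne'
    have hle : riemannRochSpace D ≤ Subalgebra.toSubmodule (⊥ : Subalgebra K F) := fun x hx ↦ by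
      rw [Subalgebra.mem_toSubmodule, Algebra.mem_bot]; exact hne' x hx
    have hbot : Module.finrank K (Subalgebra.toSubmodule (⊥ : Subalgebra K F)) = 1 := by
      rw [Subalgebra.finrank_toSubmodule, Subalgebra.finrank_bot]
    haveI : Module.Finite K (Subalgebra.toSubmodule (⊥ : Subalgebra K F)) :=
      Module.finite_of_finrank_eq_succ hbot
    have h1' : Module.finrank K (riemannRochSpace D) ≤ 1 := by
      have := Submodule.finrank_mono hle
      rwa [hbot] at this
    have : ell D ≤ 1 := h1'
    omega
  obtain ⟨x, hxD, hxK⟩ := hex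
  have hx0 : x ≠ 0 := fun h ↦ hxK ⟨0, by rw [map_zero, h]⟩
  -- `1, x, …, xⁿ ∈ L(nQ)` with `n = 2g - 1`, independent: `ℓ(nQ) ≥ n + 1 = 2g`
  set n : ℕ := 2 * genus K F - 1 with hn
  have hn1 : (n : ℤ) = 2 * (genus K F : ℤ) - 1 := by omega
  haveI := finiteDimensional_riemannRochSpace_of_isAlgFunctionField (K := K) (F := F)
    (Finsupp.single Q (n : ℤ))
  let f : Fin (n + 1) → riemannRochSpace (Finsupp.single Q (n : ℤ)) := fun i =>
    ⟨x ^ (i : ℕ), pow_mem_riemannRochSpace_single hx0 hxD (Nat.lt_succ_iff.mp i.isLt)⟩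
  have hf : LinearIndependent K f := by
    refine LinearIndependent.of_comp (Submodule.subtype _) ?_
    exact linearIndependent_pow_of_not_mem_range hxK n
  have hcard := hf.fintype_card_le_finrank
  rw [Fintype.card_fin] at hcard
  have hlow : (n : ℤ) + 1 ≤ ell (Finsupp.single Q (n : ℤ)) := by
    unfold ell; exact_mod_cast hcard
  -- Riemann–Roch: `ℓ(nQ) = n + 1 - g` (`deg nQ = n > 2g - 2`)
  have hdeg : Divisor.degree (Finsupp.single Q (n : ℤ) : Divisor K F) = n := by
    rw [Divisor.degree_single, show (Q.degree : ℤ) = 1 by exact_mod_cast hQ, mul_one]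
  have hRR := ell_eq_degree_add_one_sub_genus (K := K) (F := F) (A := Finsupp.single Q (n : ℤ))
    (by rw [hdeg]; omega)
  rw [hdeg] at hRR
  omega

/-- **`L(Q) = K`** (as a `K`-subspace of `F`) for a rational place `Q` when `g ≥ 1`.
[cite: Stichtenoth2009, Prop. 1.6.3 and Lemma 1.4.7 (a)] -/
theorem riemannRochSpace_single_eq_bot_of_one_le_genus {Q : PlaceOver K F} (hQ : Q.IsRational)
    (hg : 1 ≤ genus K F) :
    riemannRochSpace (Finsupp.single Q (1 : ℤ)) = Subalgebra.toSubmodule (⊥ : Subalgebra K F) := by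
  haveI := finiteDimensional_riemannRochSpace_of_isAlgFunctionField (K := K) (F := F)
    (Finsupp.single Q (1 : ℤ))
  have hle : Subalgebra.toSubmodule (⊥ : Subalgebra K F) ≤ riemannRochSpace (Finsupp.single Q (1 : ℤ)) := by
    rw [← riemannRochSpace_zero_eq_bot]
    exact riemannRochSpace_mono (Finsupp.single_nonneg.2 zero_le_one)
  refine (Submodule.eq_of_le_of_finrank_le hle ?_).symm
  rw [show Module.finrank K (riemannRochSpace (Finsupp.single Q (1 : ℤ))) = 1 from
    ell_single_eq_one_of_one_le_genus hQ hg, Subalgebra.finrank_toSubmodule, Subalgebra.finrank_bot]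

/-- **Distinct rational places are not linearly equivalent when `g ≥ 1`**: if `P ∼ Q` for rational
places `P, Q` of a function field of genus `≥ 1`, then `P = Q` (a function `x` with `(x) = P − Q`,
`P ≠ Q`, would be a non-constant element of `L(Q)`). This is the injectivity-on-points step of
Milne, *Jacobian Varieties*, Prop. 2.3. [cite: Milne1986JacobianVarieties, §2 Prop. 2.3 (proof)] [cite: Stichtenoth2009, Prop. 1.6.3] -/
theorem eq_of_single_isLinearlyEquivalent_single {P Q : PlaceOver K F} (hQ : Q.IsRational)
    (hg : 1 ≤ genus K F)
    (h : Divisor.IsLinearlyEquivalent (Finsupp.single P (1 : ℤ) : Divisor K F) (Finsupp.single Q 1)) :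
    P = Q := by
  classical
  by_contra hPQ
  obtain ⟨x, hx0, hx⟩ := h
  -- `(x) = P - Q`, so `x ∈ L(Q)` and `x ∉ K` (it has a zero at `P`)
  have hxQ : x ∈ riemannRochSpace (Finsupp.single Q (1 : ℤ)) := by
    rw [mem_riemannRochSpace_iff_neg_le_ord _ hx0]
    intro v
    rw [← principalDivisor_apply_of_ne_zero hx0 v, hx]
    by_cases hvQ : v = Q
    · subst hvQ
      rw [Finsupp.sub_apply, Finsupp.single_eq_same, Finsupp.single_eq_of_ne (Ne.symm hPQ)]; norm_num
    · rw [Finsupp.single_eq_of_ne hvQ, neg_zero, Finsupp.sub_apply, Finsupp.single_eq_of_ne hvQ,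
        sub_zero]
      exact Finsupp.single_nonneg.2 zero_le_one v
  have hxK : x ∈ Subalgebra.toSubmodule (⊥ : Subalgebra K F) := by
    rw [← riemannRochSpace_single_eq_bot_of_one_le_genus hQ hg]; exact hxQ
  rw [Subalgebra.mem_toSubmodule, Algebra.mem_bot] at hxK
  obtain ⟨c, rfl⟩ := hxK
  -- a constant has principal divisor `0 ≠ P - Q`
  have hc : c ≠ 0 := fun h ↦ hx0 (by rw [h, map_zero])
  have hc0 : principalDivisor K (algebraMap K F c) = 0 := principalDivisor_algebraMap hc
  rw [hc0] at hx
  have := congrArg (fun D : Divisor K F => D P) hx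
  simp only [Finsupp.coe_zero, Pi.zero_apply, Finsupp.sub_apply, Finsupp.single_eq_same,
    Finsupp.single_eq_of_ne hPQ] at this
  norm_num at this

/-- `P ∼ Q ↔ P = Q` for rational places of a function field of genus `≥ 1`.
[cite: Milne1986JacobianVarieties, §2 Prop. 2.3 (proof)] -/
theorem single_isLinearlyEquivalent_single_iff_of_one_le_genus {P Q : PlaceOver K F}
    (hQ : Q.IsRational) (hg : 1 ≤ genus K F) :
    Divisor.IsLinearlyEquivalent (Finsupp.single P (1 : ℤ) : Divisor K F) (Finsupp.single Q 1) ↔ P = Q := by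
  refine ⟨eq_of_single_isLinearlyEquivalent_single hQ hg, ?_⟩
  rintro rfl
  exact ⟨1, one_ne_zero, by rw [sub_self]; exact principalDivisor_one⟩

/-! ## §2 (ed. 2) The canonical system has no base points when `g ≥ 1` -/

/-- **`ℓ(W − Q) = g − 1` for a canonical divisor `W = (ω)` and a rational place `Q`, `g ≥ 1`**:
Riemann–Roch (Stichtenoth Thm. 1.5.15) at `A = Q` reads `ℓ(Q) = 1 + 1 − g + ℓ(W − Q)`, and
`ℓ(Q) = 1` (§1). With `ℓ(W) = g` (Cor. 1.5.16) this says `ℓ(W − Q) = ℓ(W) − 1`, i.e. `Q` is not a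
base point of the canonical system `|W|` (Hartshorne IV, Prop. 3.1 (a); Lemma 5.1 for `g ≥ 2`, and
for `g = 1` both sides vanish). [cite: Stichtenoth2009, Thm. 1.5.15 and Cor. 1.5.16] [cite: Hartshorne1977, IV Prop. 3.1 (a) and Lemma 5.1] -/
theorem ell_differentialDivisor_sub_single_of_one_le_genus {ω : weilDifferential K F} (hω : ω ≠ 0)
    {Q : PlaceOver K F} (hQ : Q.IsRational) (hg : 1 ≤ genus K F) :
    ell (differentialDivisor ω - Finsupp.single Q (1 : ℤ)) = genus K F - 1 := by
  have hRR := ell_eq_of_differentialDivisor hω (Finsupp.single Q (1 : ℤ))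
  rw [ell_single_eq_one_of_one_le_genus hQ hg, Divisor.degree_single,
    show (Q.degree : ℤ) = 1 by exact_mod_cast hQ, mul_one] at hRR
  omega

/-- **`ℓ(W − Q) + 1 = ℓ(W)`** (`W = (ω)` canonical, `Q` rational, `g ≥ 1`): the canonical system
`|W|` has no base point at `Q`. [cite: Hartshorne1977, IV Prop. 3.1 (a) and Lemma 5.1] [cite: Stichtenoth2009, Thm. 1.5.15 and Cor. 1.5.16] -/
theorem ell_differentialDivisor_sub_single_add_one {ω : weilDifferential K F} (hω : ω ≠ 0)
    {Q : PlaceOver K F} (hQ : Q.IsRational) (hg : 1 ≤ genus K F) :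
    ell (differentialDivisor ω - Finsupp.single Q (1 : ℤ)) + 1 = ell (differentialDivisor ω) := by
  rw [ell_differentialDivisor_sub_single_of_one_le_genus hω hQ hg, ell_differentialDivisor hω]
  omega

/-- **For `g ≥ 1` every rational place `Q` carries a Weil differential `ω ≠ 0` with `ω ∉ Ω(Q)`,
i.e. some element of `L(W)` is missing from `L(W − Q)`**: `L(W − Q) ⊊ L(W)` since
`ℓ(W − Q) = ℓ(W) − 1`. [cite: Hartshorne1977, IV Prop. 3.1 (a) and Lemma 5.1] -/
theorem riemannRochSpace_differentialDivisor_sub_single_lt {ω : weilDifferential K F} (hω : ω ≠ 0)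
    {Q : PlaceOver K F} (hQ : Q.IsRational) (hg : 1 ≤ genus K F) :
    riemannRochSpace (differentialDivisor ω - Finsupp.single Q (1 : ℤ)) <
      riemannRochSpace (differentialDivisor ω) := by
  haveI := finiteDimensional_riemannRochSpace_of_isAlgFunctionField (K := K) (F := F) (differentialDivisor ω)
  refine lt_of_le_of_ne (riemannRochSpace_mono ?_) fun h => ?_
  · exact sub_le_self _ (Finsupp.single_nonneg.2 zero_le_one)
  · have h1 := ell_differentialDivisor_sub_single_add_one hω hQ hg
    unfold ell at h1
    rw [h] at h1
    omega

end Literature.NumberTheory.DiophantineGeometry.AlgFunctionField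

end
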